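import Literature.Geometry.DiscreteGeometry.ShellCensusReplayLPSound
import HarnessLib

/-!
# Text format and composition for census certificates with LP leaves

Topic `Literature/Geometry/DiscreteGeometry`; part 3 of 3 of the replayer extension
`ShellCensusReplayLP.lean` (certificate stubs `stub_ffrC5NoOpenStar` / `stub_ffrC5NoFarFacet` of
crux `FiveFoldRationingR`, stmt-AtomisticToContinuum-18071): the decoder `LCensus.ofText` of a
census with LP leaves shipped as a string of integers, reusing the tokenizer and the readers of
`ShellCensusReplay.lean` (`Text.tokens`, `natAt`, `intAt`, `ratAt`, `readNats`, `readConstraints`,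
`decodeWitness`), and the composition of certificates split over several files
(`LCensus.claims_append_of_checkFrom`, as in `ShellCensusReplayEscapeSound.lean`). Grammar
(prefix, all tokens integers): that of `ECensus.ofText` —

* census := `E` entry₁ … entry_E; entry := `L` (k l b)ᴸ tree (`b ∈ {0,1}`: far/bond);
* tree := `0 k l` tree tree (case) ∣ `1 L π₀…π_{L−1} j` (ref) ∣ `2` tree (frame)
  ∣ `3 axis num den` tree tree (split at `num/den`) ∣ `4` witness (empty)
  ∣ `5 pat (num den)⁹ L σ₀…σ_{L−1}` (accept) ∣ `6 pat a b c d s L σ₀…σ_{L−1}` (accept, quaternion)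
  ∣ `7 k` (torn) ∣ `8 k` (capped) ∣ `9 l prec` (aboveFacet)

— extended by the LP leaf

* `10 cnum cden L (gen λnum λden)ᴸ` (lp with `c = cnum/cden` and `L` weighted generators),
  gen := `0 k` (normLo) ∣ `1 k` (normHi) ∣ `2 k l` (core) ∣ `3 k l` (bond) ∣ `4 k l` (far)
  ∣ `5 a` (bfLo) ∣ `6 a` (bfHi) ∣ `7 a sa b sb` (prod; sides `0` = lower, `1` = upper).

The degree window, the facet labels and the target constraint list are ARGUMENTS of
`LCensus.check`, not data. Malformed input decodes to the empty census, which fails every check;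
the decoder needs no correctness proof (soundness is about whatever census it returns);
`toyLCensus_decode` reads the toy census of part 1 back from its token form in the kernel.
Intended use: `LCensus.infeasible_of_check rfl (LCensus.ofText "<tokens>") (by native_decide)`;
keep `≲ 10⁷` tokens per file and chain files with `LCensus.claims_append_of_checkFrom`.
-/

namespace Literature.Geometry.DiscreteGeometry

open Literature.Analysis.ValidatedNumerics

namespace ShellCensus

/-! ### The decoder -/

namespace Text

/-- Decode a generator at position `i`; returns it and the next position. [folklore] -/
def decodeGen (ts : Array ℤ) (i : ℕ) : Option (Gen × ℕ) :=
  let tag := intAt ts i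
  if tag = 0 then some (.normLo (natAt ts (i + 1)), i + 2)
  else if tag = 1 then some (.normHi (natAt ts (i + 1)), i + 2)
  else if tag = 2 then some (.core (natAt ts (i + 1)) (natAt ts (i + 2)), i + 3)
  else if tag = 3 then some (.bond (natAt ts (i + 1)) (natAt ts (i + 2)), i + 3)
  else if tag = 4 then some (.far (natAt ts (i + 1)) (natAt ts (i + 2)), i + 3)
  else if tag = 5 then some (.bfLo (natAt ts (i + 1)), i + 2)
  else if tag = 6 then some (.bfHi (natAt ts (i + 1)), i + 2)
  else if tag = 7 then some (.prod (natAt ts (i + 1)) (intAt ts (i + 2) == 1) (natAt ts (i + 3))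
    (intAt ts (i + 4) == 1), i + 5)
  else none

/-- Read `len` weighted generators `gen λnum λden` from position `i`. [folklore] -/
def readGens (ts : Array ℤ) : ℕ → ℕ → Option (List (Gen × ℚ) × ℕ)
  | 0, i => some ([], i)
  | len + 1, i =>
    match decodeGen ts i with
    | none => none
    | some (g, j) =>
      match readGens ts len (j + 2) with
      | none => none
      | some (rest, j') => some ((g, ratAt ts j) :: rest, j')

/-- Decode a tree with LP leaves at position `i` (`fuel` bounds the depth). [folklore] -/
def decodeLTree (ts : Array ℤ) : ℕ → ℕ → Option (LTree × ℕ)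
  | 0, _ => none
  | fuel + 1, i =>
    let tag := intAt ts i
    if tag = 0 then
      match decodeLTree ts fuel (i + 3) with
      | none => none
      | some (tb, j) =>
        match decodeLTree ts fuel j with
        | none => none
        | some (tf, j') => some (.case (natAt ts (i + 1)) (natAt ts (i + 2)) tb tf, j')
    else if tag = 1 then
      let r := readNats ts (natAt ts (i + 1)) (i + 2)
      some (.ref r.1 (natAt ts r.2), r.2 + 1)
    else if tag = 2 then
      match decodeLTree ts fuel (i + 1) with
      | none => none
      | some (t, j) => some (.frame t, j)
    else if tag = 3 then
      match decodeLTree ts fuel (i + 4) with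
      | none => none
      | some (lo, j) =>
        match decodeLTree ts fuel j with
        | none => none
        | some (hi, j') => some (.split (natAt ts (i + 1)) (ratAt ts (i + 2)) lo hi, j')
    else if tag = 4 then
      match decodeWitness ts (i + 1) with
      | none => none
      | some (w, j) => some (.empty w, j)
    else if tag = 5 then
      let M := (List.range 9).map fun e => ratAt ts (i + 2 + 2 * e)
      let r := readNats ts (natAt ts (i + 20)) (i + 21)
      some (.accept (natAt ts (i + 1)) M r.1, r.2)
    else if tag = 6 then
      let M := quatMat (intAt ts (i + 2)) (intAt ts (i + 3)) (intAt ts (i + 4)) (intAt ts (i + 5))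
        (intAt ts (i + 6))
      let r := readNats ts (natAt ts (i + 7)) (i + 8)
      some (.accept (natAt ts (i + 1)) M r.1, r.2)
    else if tag = 7 then some (.torn (natAt ts (i + 1)), i + 2)
    else if tag = 8 then some (.capped (natAt ts (i + 1)), i + 2)
    else if tag = 9 then some (.aboveFacet (natAt ts (i + 1)) (natAt ts (i + 2)), i + 3)
    else if tag = 10 then
      match readGens ts (natAt ts (i + 3)) (i + 4) with
      | none => none
      | some (lams, j) => some (.lp (ratAt ts (i + 1)) lams, j)
    else none

/-- Decode `count` entries from position `i`. [folklore] -/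
def decodeLEntries (ts : Array ℤ) : ℕ → ℕ → Option LCensus
  | 0, _ => some []
  | count + 1, i =>
    let r := readConstraints ts (natAt ts i) (i + 1)
    match decodeLTree ts (ts.size + 1) r.2 with
    | none => none
    | some (t, j) =>
      match decodeLEntries ts count j with
      | none => none
      | some rest => some ((r.1, t) :: rest)

end Text

/-- **Decode a census with LP leaves from its text form** (the empty census on malformed input). [folklore] -/
def LCensus.ofText (s : String) : LCensus :=
  let ts := Text.tokens s
  (Text.decodeLEntries ts (Text.natAt ts 0) 1).getD []

/-- The token form of `toyLCensus` (grammar of `LCensus.ofText`). [folklore] -/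
def toyLToks : Array ℤ :=
  #[2, 1, 0, 1, 0, 2, 3, 3, 2, 1, 10, 1, 1, 14, 4, 0, 1, 1, 1, 7, 0, 0, 0, 1, 1, 1, 7, 3, 0, 3, 1, 1, 1,
    6, 3, 2, 1, 7, 0, 0, 3, 0, 2, 1, 7, 1, 0, 1, 1, 1, 1, 7, 4, 0, 4, 1, 1, 1, 7, 1, 0, 4, 0, 2, 1,
    7, 2, 0, 2, 1, 1, 1, 6, 2, 2, 1, 7, 5, 0, 5, 1, 1, 1, 7, 2, 0, 5, 0, 1, 1, 7, 2, 1, 5, 1, 1, 1,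
    5, 5, 2, 1, 4, 0, 3, 0, 0, 0, 1, 8, 0, 1, 3, 0, 1, 2, 0]

/-- The decoder reads the token form of the toy census back (kernel evaluation). [folklore] -/
theorem toyLCensus_decode :
    Text.decodeLEntries toyLToks (Text.natAt toyLToks 0) 1 = some toyLCensus := by
  decide +kernel

/-! ### Composition across files -/

/-- The context array of a census: its constraint lists, in order. [folklore] -/
def LCensus.ctx (C : LCensus) : Array (List Constraint) := (C.map Prod.fst).toArray

/-- Established entries give an established context. [folklore] -/
theorem LCensus.eclaim_ctx {P : Spec} {Q : P.Patterns} {dmin dmax : ℕ} {f : Option (ℕ × ℕ × ℕ)}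
    {C : LCensus} (h : ∀ e ∈ C, P.EClaim Q dmin dmax f e.1) :
    ∀ (j : ℕ) (hj : j < C.ctx.size), P.EClaim Q dmin dmax f C.ctx[j] := by
  intro j hj
  simp only [LCensus.ctx, List.getElem_toArray, List.getElem_map]
  exact h _ (List.getElem_mem _)

/-- **Composition of certificates**: if the entries of `C₀` are established and `C` checks
against the context `C₀.ctx`, then all entries of `C₀ ++ C` are established. [folklore] -/
theorem LCensus.claims_append_of_checkFrom {P : Spec} (Q : P.Patterns) {dmin dmax : ℕ}
    {f : Option (ℕ × ℕ × ℕ)} (hP : P.okB = true) (C₀ C : LCensus)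
    (h₀ : ∀ e ∈ C₀, P.EClaim Q dmin dmax f e.1)
    (h : LCensus.checkFrom P dmin dmax f C₀.ctx C = true) :
    ∀ e ∈ C₀ ++ C, P.EClaim Q dmin dmax f e.1 := by
  intro e he
  rcases List.mem_append.1 he with he | he
  · exact h₀ e he
  · exact LCensus.checkFrom_sound Q hP C C₀.ctx (LCensus.eclaim_ctx h₀) h e he

/-- The empty census is (vacuously) established — the start of a chain. [folklore] -/
theorem LCensus.claims_nil {P : Spec} (Q : P.Patterns) {dmin dmax : ℕ} {f : Option (ℕ × ℕ × ℕ)} :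
    ∀ e ∈ ([] : LCensus), P.EClaim Q dmin dmax f e.1 := by
  simp

/-- Extracting the target claim from established entries. [folklore] -/
theorem Spec.eclaim_of_lclaims {P : Spec} {Q : P.Patterns} {dmin dmax : ℕ} {f : Option (ℕ × ℕ × ℕ)}
    {C : LCensus} {S : List Constraint} (h : ∀ e ∈ C, P.EClaim Q dmin dmax f e.1)
    (hS : (C.any fun e => decide (e.1 = S)) = true) : P.EClaim Q dmin dmax f S := by
  obtain ⟨e, he, he'⟩ := List.any_eq_true.1 hS
  rw [decide_eq_true_eq] at he'
  exact he' ▸ h e he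

/-- **Infeasibility from a chain of certificate files** (specifications without anchors): with
`Q := P.emptyPatterns hA`, `part₀ := LCensus.claims_nil Q`,
`partᵢ₊₁ := LCensus.claims_append_of_checkFrom Q hP (C₁ ++ ⋯ ++ Cᵢ) Cᵢ₊₁ partᵢ (by native_decide)`,
and finally `LCensus.infeasible_of_claims hA part_k (by native_decide)`. [folklore] -/
theorem LCensus.infeasible_of_claims {P : Spec} (hA : P.anchors = []) {dmin dmax : ℕ}
    {f : Option (ℕ × ℕ × ℕ)} {C : LCensus} {S : List Constraint}
    (h : ∀ e ∈ C, P.EClaim (P.emptyPatterns hA) dmin dmax f e.1)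
    (hS : (C.any fun e => decide (e.1 = S)) = true) :
    ∀ t : Fin P.n → EuclideanSpace ℝ (Fin 3),
      P.Admissible t → P.DegOK dmin dmax t → P.FacetLE f t → P.Sat S t → False :=
  Spec.EClaim.elim_nil hA (Spec.eclaim_of_lclaims h hS)

/-- End-to-end on the toy census: no three unit vectors with pairwise distances `≤ 1/10` or
`≥ 3` have no `1/10`-close partner each. -/
example : ∀ t : Fin 3 → EuclideanSpace ℝ (Fin 3), toyLSpec.Admissible t → toyLSpec.DegOK 0 0 t →
    toyLSpec.FacetLE none t → toyLSpec.Sat [] t → False :=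
  LCensus.infeasible_of_check rfl toyLCensus toyLCensus_check

/-- The same, with the toy census split into two chained one-entry files. -/
example : ∀ t : Fin 3 → EuclideanSpace ℝ (Fin 3), toyLSpec.Admissible t → toyLSpec.DegOK 0 0 t →
    toyLSpec.FacetLE none t → toyLSpec.Sat [] t → False :=
  LCensus.infeasible_of_claims (P := toyLSpec) (dmin := 0) (dmax := 0) (f := none) (S := []) rfl
    (LCensus.claims_append_of_checkFrom _ rfl (toyLCensus.take 1) (toyLCensus.drop 1)
      (LCensus.claims_append_of_checkFrom _ rfl [] (toyLCensus.take 1) (LCensus.claims_nil _)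
        (by decide +kernel)) (by decide +kernel))
    (by decide +kernel)

end ShellCensus

end Literature.Geometry.DiscreteGeometry
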